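import Summits.CriticalPhenomena.Ising3DConformalLimit.Theses.PerfectScreening
import Summits.CriticalPhenomena.Ising3DConformalLimit.Theses.EnergyNotSigmaSquared
import Summits.CriticalPhenomena.Ising3DConformalLimit.Theses.HyperoctahedralRP
import Summits.CriticalPhenomena.Ising3DConformalLimit.Theses.PositivityBegetsConformality
import Summits.CriticalPhenomena.Ising3DConformalLimit.Theorems.MoebiusLimitExists.Negative.MeshContinuity
import Summits.CriticalPhenomena.Ising3DConformalLimit.Theorems.PrecisionLaplacianMoebiusLimitOfTwoPointLawInversionBegetsRotations
import Summits.CriticalPhenomena.Ising3DConformalLimit.Theorems.EnergyNotSigmaSquaredMoebiusLimitExistsHrpFactorisation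
import Summits.CriticalPhenomena.Ising3DConformalLimit.Theorems.MoebiusLimitExists.Negative.InversionContent
import Summits.CriticalPhenomena.Ising3DConformalLimit.Theorems.HyperoctahedralRPTwoPointLimitIsotropicHolds
import Summits.CriticalPhenomena.Ising3DConformalLimit.Theorems.EnergyNotSigmaSquaredMoebiusLimitExistsOneMapOneJetDefs
import Summits.CriticalPhenomena.Ising3DConformalLimit.Theorems.EnergyNotSigmaSquaredMoebiusLimitExistsOneMapOneJetLowOrders
import Summits.CriticalPhenomena.Ising3DConformalLimit.Theorems.EnergyNotSigmaSquaredMoebiusLimitExistsOneMapOneJetDictionary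
import Summits.CriticalPhenomena.Ising3DConformalLimit.Theorems.EnergyNotSigmaSquaredMoebiusLimitExistsOneMapOneJetDensity
import Summits.CriticalPhenomena.Ising3DConformalLimit.Theorems.EnergyNotSigmaSquaredMoebiusLimitExistsOneMapOneJetJetReduction
import Summits.CriticalPhenomena.Ising3DConformalLimit.Theorems.EnergyNotSigmaSquaredMoebiusLimitExistsOneMapOneJetAnalyticity
import Literature.Probability.LatticeModels.ConformalCovariance
import HarnessLib
import HarnessLib.Audit

/-!
# Line `one-map-one-jet` for crux `MoebiusLimitExists` (stmt-CriticalPhenomena-1344) — skeleton v5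
(lead prover-line-stmt-CriticalPhenomena-1344-c5-0, 2026-08-16; v1 = planner
planner-cruxplan-stmt-CriticalPhenomena-1344-one-map-one-jet-0, `Lines/one-map-one-jet.lean`)

Crux (by name): `Theses.PerfectScreening.MoebiusLimitExists` = `Theses.EnergyNotSigmaSquared.MoebiusLimit`
(same term; primary route `route-CriticalPhenomena-EnergyNotSigmaSquared`):

  `∃ ρ Δ S, (∀ δ ∈ (0,1], 0 < ρ δ) ∧ 0 < Δ ∧ HasPointwiseScalingLimit (criticalCorr 3) ρ S ∧
     IsNondegenerateTwoPoint S ∧ IsMoebiusCovariant Δ S`.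

THE LINE (unchanged idea). Take the witness `(ρ, Δ, S)` of the existence item stmt-CriticalPhenomena-1981
(`HyperoctahedralRP.ExistsScaleCovariantLimit`: pointwise limit of `criticalCorr 3`, normalised off
`NonCoincident`, non-degenerate, translation invariant, scale covariant — NO rotations), BY NAME. Mesh
continuity (tree theorem) makes `S n` continuous off the diagonals; nine-mirror reflection positivity ⇒
Osterwalder–Schrader holomorphy ⇒ joint real-analyticity of `S n` on `GoodConfig n` (stub 2); the inversion
defect `D_n = S n ∘ ι − (∏‖x i‖^{2Δ}) S n` is then real-analytic on the doubly-good punctured set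
`InvGoodConfig n`, so by the identity theorem along paths, density of `InvGoodConfig n` in the punctured
non-coincident set (stub 3a), continuity and normalisation, `IsInversionCovariant Δ S` follows from the
vanishing of the GERM of `D_n` at one point of the path-component of every doubly-good configuration
(stub 4 ⇐ stub 5); rotations follow from inversion + translations (item stmt-CriticalPhenomena-4675
`InversionBegetsRotations`, PROVED: `PrecisionLaplacianMoebiusLimitOfTwoPointLaw.stub_inversionBegetsRotations`),
so `MoebiusLimitExists_of : ExistsScaleCovariantLimit → MoebiusLimitExists` has ONE hypothesis by name.

RESHAPE v1 → v2 (lead c5, at adoption; composition idea unchanged, `ledger skeleton check` re-run):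
* `stub_meshContinuity` is DISCHARGED (tree theorem
  `LimitMeshContinuity.continuousOn_limit_of_translationInvariant`, landed for this very stub) — no longer a stub.
* `stub_goodConfigGeometry` (preconnected ∧ dense) is SPLIT: its density half is the registered stub
  `stub_invGoodConfig_dense` (provable now: perturb along the ray configuration `rayCfg`, a cubic
  non-vanishing argument); its preconnectedness half is NOT registered — instead stubs 4/5 are re-cut
  "per path-component": stub 5 delivers, for every doubly-good `x`, a point `x₀` JOINED TO `x` INSIDE
  `InvGoodConfig n` (`JoinedIn`) at which the germ of `D_n` vanishes, and stub 4 runs the identity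
  theorem along that path (`IsPreconnected` of a path image is free). Mathematically nothing changes
  when `InvGoodConfig n` is connected (it is the complement, in the punctured non-coincident
  configurations, of finitely many codimension-≥ 2 linear subspaces and their `ι`-images — conjecturally
  connected, and then ONE germ per `n` suffices, the planner's "one jet"); but no complement-of-
  codimension-2 connectivity theorem (absent from Mathlib for curved pieces) is load-bearing any more.
* item 4675 is consumed as a THEOREM, not a hypothesis.
* Objects live in the reviewed Defs file `Theorems/EnergyNotSigmaSquaredMoebiusLimitExistsOneMapOneJetDefs.lean`
  (p119746, ACCEPTED); the low-order analysis in `…OneMapOneJetLowOrders.lean` (p120226, ACCEPTED); the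
  dictionary/tightness of the residual in `…OneMapOneJetDictionary.lean` (p120254, ACCEPTED) — all imported (v4).

RESHAPE v2 → v3 (lead c5, same session): the v2 residual `stub_inversionGermOfAnalyticLimit` is now a
THEOREM from the narrower registered stub `stub_inversionGerm_even_ge_four` (even orders `n ≥ 4` only) and
the kernel-checked low-order analysis `inversionDefect_eq_zero_of_lt_four_or_odd` (orders `0, 2` and all odd
orders carry no inversion content for a 1981-type limit: `S₀` is `ι`-blind, odd `S_n ≡ 0`, and `S₂` is
`A‖p − q‖^{-2Δ}` because two-point isotropy is the tree theorem `twoPointLimitIsotropic_proof`).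

Registered stubs after wave 1 (ONE open): `stub_inversionGerm_even_ge_four` (hardest, lead = the conjecture content).
LANDED: `stub_nineMirrorAnalyticity` (p121553), `stub_invGoodConfig_dense` (p120310), `stub_onePointJetReduction` (p120309).
Tightness/dictionary (sorry-free, below): `stub_inversionGerm_of_inversionCovariant` (any proof of
inversion covariance of such limits — e.g. items 1980 ∧ 1982 — gives stub 5 verbatim).

Disproof.lean (cdisprove, through gen 4) honoured as in v1: `cruxWithoutLimit_holds` (lattice clause kept
in stubs 2/5), `crux_iff_normalised` (normalisation carried), `not_cruxWithInversionAtOrigin` (germ points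
punctured; conclusion = tree `IsInversionCovariant`, off the pole), `crux_iff_inversion` (the line's shape
IS existence + inversion), `MoebiusDecoys` / DSI mixture (stub 5 keeps lattice provenance); §F/§G concern
line A only. No `_false_without_` theorem bites (none quantifies over B's stubs).
-/

noncomputable section

open Set Function Filter EuclideanGeometry
open scoped Topology
open Literature.Probability.LatticeModels

namespace Summit.CriticalPhenomena.Ising3DConformalLimit.MoebiusLimitExistsOneMapOneJet

/-! ## Stub 1 (v1) — DISCHARGED: mesh continuity is a tree theorem -/

/-- **Mesh continuity** (v1 `stub_meshContinuity`, verbatim signature; no longer a stub): a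
translation-invariant full-filter pointwise scaling limit of lattice cell functions is continuous off the
diagonals — tree theorem `LimitMeshContinuity.continuousOn_limit_of_translationInvariant`. [folklore] -/
theorem stub_meshContinuity :
    ∀ (G : LatticeCorrFamily 3) (ρ : ℝ → ℝ) (S : CorrFamily 3),
      HasPointwiseScalingLimit G ρ S → IsTranslationInvariant S →
      ∀ n, ContinuousOn (S n) (NonCoincident 3 n) :=
  fun _ _ _ hlim htr n =>
    Summit.CriticalPhenomena.Ising3DConformalLimit.LimitMeshContinuity.continuousOn_limit_of_translationInvariant
      hlim htr n

/-! ## Registered stubs (v2) -/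

/-! ## Stub 2 — LANDED (wave 1): nine-mirror analyticity is a THEOREM

`stub_nineMirrorAnalyticity` — tree theorem, `Theorems/EnergyNotSigmaSquaredMoebiusLimitExistsOneMapOneJetAnalyticity.lean`
(p121553, UNCONDITIONAL, standard axioms; lead c5's stub-worker): nine-mirror OS positivity of the limit
(`NullLaplacianEdgeGaussianity.stub_nineMirrorRP`), half-plane holomorphy of the two-cluster functions
(`halfPlaneHolomorphy_of_inPlaneLightCone`, Glimm–Jaffe Thm 6.1.3), locally uniform directional analyticity
(`Literature.MathematicalPhysics.QuantumFieldTheory.eventually_exists_disc_extension_pointShift`) and the new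
`3n`-fold local cross theorem `Literature.Analysis.Complex.exists_holomorphic_extension_of_separately_local_fintype`
(p120961, Bernstein/Siciak/Jarnicki–Pflug). Imported above and used BY NAME in `MoebiusLimitExists_of`. -/

/-! ## Stubs 3a and 4 — LANDED (wave 1, lead c5's stub-workers)

* `stub_invGoodConfig_dense : ∀ n, PuncturedNonCoincident n ⊆ closure (InvGoodConfig n)` — tree theorem,
  `Theorems/EnergyNotSigmaSquaredMoebiusLimitExistsOneMapOneJetDensity.lean` (p120310; perturbation along the
  ray configuration, non-zero real polynomials have no small positive roots).
* `stub_onePointJetReduction` — tree theorem, `Theorems/EnergyNotSigmaSquaredMoebiusLimitExistsOneMapOneJetJetReduction.lean`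
  (p120309; `ι` and the weights are real-analytic off the pole, identity theorem along `JoinedIn.somePath`,
  density + continuity, normalisation at coincident punctured configurations).
Both are imported above and used BY NAME in `MoebiusLimitExists_of`. -/

/-- **Stub 5′ — inversion germ of the analytic limit at the EVEN orders `n ≥ 4` (open; HARDEST; the
residual crux, honestly named; v3 = v2 minus the orders that carry no content).** For every normalised,
non-degenerate, translation-invariant, scale-covariant (`0 < Δ`) pointwise scaling limit of the critical
`ℤ³` correlators that is continuous off the diagonals and real-analytic on the good configurations, every
EVEN `n ≥ 4` and every doubly-good `x`, there is a point `x₀` joined to `x` inside `InvGoodConfig n`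
(prover's choice — e.g. on the fixed unit sphere of `ι`, where order 0 is free:
`inversionDefect_eq_zero_of_norm_eq_one`) at which the inversion defect has vanishing germ. By stubs 3a–4
and `inversionDefect_eq_zero_of_lt_four_or_odd` this is EQUIVALENT to inversion covariance of that limit,
i.e. clause (ii) of the crux minus rotations (item 4675) for the analytic limit — the cross-ratio structure
of `S₄, S₆, …`; crux-implied and implied by items 1980 ∧ 1982 (`stub_inversionGerm_of_items`). Order 1 at
a cospherical point is the equal-radial-weights law `(x_i·∇_i + Δ) S_n = 0` spin by spin (sum over `i` =
the scale Ward identity), which at `n = 4` on all spheres is already Möbius covariance of `S₄`; higher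
orders / `n ≥ 6` carry no mechanism yet. NOT claimed to follow from RP + Euclid + scale (false without
lattice provenance: phase-averaged DSI generalised free field, TRIAGE r1-2/r1-3; `ScaleCovarianceNotMoebius`);
`HasPointwiseScalingLimit (criticalCorr 3) ρ S` is load-bearing (`cruxWithoutLimit_holds`). -/
theorem stub_inversionGerm_even_ge_four :
    ∀ (ρ : ℝ → ℝ) (Δ : ℝ) (S : CorrFamily 3), (∀ δ ∈ Set.Ioc (0:ℝ) 1, 0 < ρ δ) → 0 < Δ →
      HasPointwiseScalingLimit (criticalCorr 3) ρ S →
      (∀ n z, z ∉ NonCoincident 3 n → S n z = 0) → IsNondegenerateTwoPoint S →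
      IsTranslationInvariant S → IsScaleCovariant Δ S →
      (∀ n, ContinuousOn (S n) (NonCoincident 3 n)) →
      (∀ n, AnalyticOnNhd ℝ (S n) (GoodConfig n)) →
      ∀ n, 4 ≤ n → Even n → ∀ x ∈ InvGoodConfig n, ∃ x₀, JoinedIn (InvGoodConfig n) x x₀ ∧
        inversionDefect Δ S n =ᶠ[𝓝 x₀] 0 := by
  sorry

/-- Every doubly-good configuration has a NEIGHBOURHOOD of configurations avoiding the pole (all
`x i ≠ 0` is an open condition). [folklore] -/
theorem eventually_forall_ne_zero {n : ℕ} {x : Fin n → EuclideanSpace ℝ (Fin 3)} (hx : ∀ i, x i ≠ 0) :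
    ∀ᶠ y in 𝓝 x, ∀ i, y i ≠ 0 := by
  have h : ∀ i, ∀ᶠ y in 𝓝 x, y i ≠ 0 := fun i =>
    ((continuous_apply i).continuousAt (x := x)).eventually_ne (hx i)
  exact eventually_all.2 h

/-- **The v2 residual is a THEOREM from stub 5′** (`stub_inversionGerm_even_ge_four`) and the low-order
analysis: at orders `n < 4` and odd orders the defect vanishes on a whole neighbourhood of every doubly-good
`x` (`inversionDefect_eq_zero_of_lt_four_or_odd`, `eventually_forall_ne_zero`), so `x₀ := x` with the
constant path does it. [folklore] -/
theorem stub_inversionGermOfAnalyticLimit :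
    ∀ (ρ : ℝ → ℝ) (Δ : ℝ) (S : CorrFamily 3), (∀ δ ∈ Set.Ioc (0:ℝ) 1, 0 < ρ δ) → 0 < Δ →
      HasPointwiseScalingLimit (criticalCorr 3) ρ S →
      (∀ n z, z ∉ NonCoincident 3 n → S n z = 0) → IsNondegenerateTwoPoint S →
      IsTranslationInvariant S → IsScaleCovariant Δ S →
      (∀ n, ContinuousOn (S n) (NonCoincident 3 n)) →
      (∀ n, AnalyticOnNhd ℝ (S n) (GoodConfig n)) →
      ∀ n, ∀ x ∈ InvGoodConfig n, ∃ x₀, JoinedIn (InvGoodConfig n) x x₀ ∧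
        inversionDefect Δ S n =ᶠ[𝓝 x₀] 0 := by
  intro ρ Δ S hρ hΔ hlim hnorm hnd htr hsc hcont han n x hx
  by_cases h4 : 4 ≤ n
  · by_cases he : Even n
    · exact stub_inversionGerm_even_ge_four ρ Δ S hρ hΔ hlim hnorm hnd htr hsc hcont han n h4 he x hx
    · refine ⟨x, JoinedIn.refl hx, ?_⟩
      filter_upwards [eventually_forall_ne_zero hx.1] with y hy
      exact inversionDefect_eq_zero_of_lt_four_or_odd ρ Δ S hρ hlim hnorm hnd htr hsc n
        (Or.inr (Nat.not_even_iff_odd.1 he)) y hy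
  · refine ⟨x, JoinedIn.refl hx, ?_⟩
    filter_upwards [eventually_forall_ne_zero hx.1] with y hy
    exact inversionDefect_eq_zero_of_lt_four_or_odd ρ Δ S hρ hlim hnorm hnd htr hsc n
      (Or.inl (by omega)) y hy

/-! ## Tightness of the re-cut: inversion covariance gives stub 5's conclusion verbatim -/

/-- **Converse of the reduction (tightness of stub 5's form)**: an inversion-covariant family has
vanishing inversion-defect germ at EVERY configuration avoiding the pole, so stub 5's conclusion holds with
`x₀ := x` and the constant path. In particular stub 5 is implied verbatim by any proof of
`IsInversionCovariant Δ S` for such limits (items 1980 ∧ 1982 of route HyperoctahedralRP; the crux itself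
by `MoebiusLimitExistsOnlyInteraction.exists_ratio_of_two_limits`). [folklore] -/
theorem stub_inversionGerm_of_inversionCovariant {Δ : ℝ} {S : CorrFamily 3}
    (hinv : IsInversionCovariant Δ S) (n : ℕ) :
    ∀ x ∈ InvGoodConfig n, ∃ x₀, JoinedIn (InvGoodConfig n) x x₀ ∧ inversionDefect Δ S n =ᶠ[𝓝 x₀] 0 := by
  intro x hx
  refine ⟨x, JoinedIn.refl hx, ?_⟩
  filter_upwards [eventually_forall_ne_zero hx.1] with y hy
  exact (isInversionCovariant_iff_inversionDefect Δ S).1 hinv n y hy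

/-- **Dictionary: stub 5 ⟸ items 1980 ∧ 1982** (route HyperoctahedralRP; `HRP2Rigidity` = item 1979 is the
tree theorem `HRP2Rigidity_of`): rotation invariance of the 1981-type limit by 1980, then inversion
covariance by 1982, then `stub_inversionGerm_of_inversionCovariant`. So stub 5 is implied verbatim by two
existing crux items (it is NOT an independent conjecture). [folklore] -/
theorem stub_inversionGerm_of_items
    (h1980 : Theses.HyperoctahedralRP.LimitRotationInvariant)
    (h1982 : Theses.HyperoctahedralRP.InversionUpgradeNormalised) :
    ∀ (ρ : ℝ → ℝ) (Δ : ℝ) (S : CorrFamily 3), (∀ δ ∈ Set.Ioc (0:ℝ) 1, 0 < ρ δ) → 0 < Δ →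
      HasPointwiseScalingLimit (criticalCorr 3) ρ S →
      (∀ n z, z ∉ NonCoincident 3 n → S n z = 0) → IsNondegenerateTwoPoint S →
      IsTranslationInvariant S → IsScaleCovariant Δ S →
      (∀ n, ContinuousOn (S n) (NonCoincident 3 n)) →
      (∀ n, AnalyticOnNhd ℝ (S n) (GoodConfig n)) →
      ∀ n, ∀ x ∈ InvGoodConfig n, ∃ x₀, JoinedIn (InvGoodConfig n) x x₀ ∧
        inversionDefect Δ S n =ᶠ[𝓝 x₀] 0 := by
  intro ρ Δ S hρ _hΔ hlim hnorm hnd htr hsc _hcont _han n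
  have hrot : IsRotationInvariant S :=
    h1980 Summit.CriticalPhenomena.Ising3DConformalLimit.Cruxes.HRP2Rigidity.XRayMellin.HRP2Rigidity_of
      ρ Δ S hρ hlim hnorm hnd htr hsc
  have hinv : IsInversionCovariant Δ S := h1982 ρ Δ S hρ hlim hnorm hnd ⟨htr, hrot⟩ hsc
  exact stub_inversionGerm_of_inversionCovariant hinv n

/-- **Tightness: the crux implies stub 5** (so stub 5 is not over-strong): the crux implies items 1980 and
1982 (`MoebiusLimitExistsOnlyInteraction.limitRotationInvariant_of_MoebiusLimitExists`,
`…inversionUpgradeNormalised_of_MoebiusLimitExists`, lead c4: any two non-degenerate limits of the critical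
correlators are proportional order by order, so covariance transfers from the Möbius witness), then
`stub_inversionGerm_of_items`. [folklore] -/
theorem stub_inversionGerm_of_crux (h : Theses.PerfectScreening.MoebiusLimitExists) :
    ∀ (ρ : ℝ → ℝ) (Δ : ℝ) (S : CorrFamily 3), (∀ δ ∈ Set.Ioc (0:ℝ) 1, 0 < ρ δ) → 0 < Δ →
      HasPointwiseScalingLimit (criticalCorr 3) ρ S →
      (∀ n z, z ∉ NonCoincident 3 n → S n z = 0) → IsNondegenerateTwoPoint S →
      IsTranslationInvariant S → IsScaleCovariant Δ S →
      (∀ n, ContinuousOn (S n) (NonCoincident 3 n)) →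
      (∀ n, AnalyticOnNhd ℝ (S n) (GoodConfig n)) →
      ∀ n, ∀ x ∈ InvGoodConfig n, ∃ x₀, JoinedIn (InvGoodConfig n) x x₀ ∧
        inversionDefect Δ S n =ᶠ[𝓝 x₀] 0 :=
  stub_inversionGerm_of_items
    (Summit.CriticalPhenomena.Ising3DConformalLimit.MoebiusLimitExistsOnlyInteraction.limitRotationInvariant_of_MoebiusLimitExists h)
    (Summit.CriticalPhenomena.Ising3DConformalLimit.MoebiusLimitExistsOnlyInteraction.inversionUpgradeNormalised_of_MoebiusLimitExists h)

/-! ## Kernel-checked composition -/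

/-- **Sorry-free certificate of the composition (v2).** With the stub STATEMENTS as hypotheses (verbatim
the signatures of `stub_meshContinuity` (discharged), `stub_nineMirrorAnalyticity`,
`stub_invGoodConfig_dense`, `stub_onePointJetReduction`, `stub_inversionGermOfAnalyticLimit`) and the
two route items by name, the DEFINIENS of the crux follows by pure logic. -/
theorem cruxBody_of_statements
    (hE : Theses.HyperoctahedralRP.ExistsScaleCovariantLimit)
    (hR : Theses.PositivityBegetsConformality.InversionBegetsRotations)
    (h₁ : ∀ (G : LatticeCorrFamily 3) (ρ : ℝ → ℝ) (S : CorrFamily 3),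
      HasPointwiseScalingLimit G ρ S → IsTranslationInvariant S →
      ∀ n, ContinuousOn (S n) (NonCoincident 3 n))
    (h₂ : ∀ (ρ : ℝ → ℝ) (Δ : ℝ) (S : CorrFamily 3), (∀ δ ∈ Set.Ioc (0:ℝ) 1, 0 < ρ δ) → 0 < Δ →
      HasPointwiseScalingLimit (criticalCorr 3) ρ S →
      (∀ n z, z ∉ NonCoincident 3 n → S n z = 0) → IsNondegenerateTwoPoint S →
      IsTranslationInvariant S → IsScaleCovariant Δ S →
      (∀ n, ContinuousOn (S n) (NonCoincident 3 n)) →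
      ∀ n, AnalyticOnNhd ℝ (S n) (GoodConfig n))
    (h₃ : ∀ n, PuncturedNonCoincident n ⊆ closure (InvGoodConfig n))
    (h₄ : ∀ (Δ : ℝ) (S : CorrFamily 3),
      (∀ n z, z ∉ NonCoincident 3 n → S n z = 0) →
      (∀ n, ContinuousOn (S n) (NonCoincident 3 n)) →
      (∀ n, AnalyticOnNhd ℝ (S n) (GoodConfig n)) →
      (∀ n, PuncturedNonCoincident n ⊆ closure (InvGoodConfig n)) →
      (∀ n, ∀ x ∈ InvGoodConfig n, ∃ x₀, JoinedIn (InvGoodConfig n) x x₀ ∧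
        inversionDefect Δ S n =ᶠ[𝓝 x₀] 0) →
      IsInversionCovariant Δ S)
    (h₅ : ∀ (ρ : ℝ → ℝ) (Δ : ℝ) (S : CorrFamily 3), (∀ δ ∈ Set.Ioc (0:ℝ) 1, 0 < ρ δ) → 0 < Δ →
      HasPointwiseScalingLimit (criticalCorr 3) ρ S →
      (∀ n z, z ∉ NonCoincident 3 n → S n z = 0) → IsNondegenerateTwoPoint S →
      IsTranslationInvariant S → IsScaleCovariant Δ S →
      (∀ n, ContinuousOn (S n) (NonCoincident 3 n)) →
      (∀ n, AnalyticOnNhd ℝ (S n) (GoodConfig n)) →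
      ∀ n, ∀ x ∈ InvGoodConfig n, ∃ x₀, JoinedIn (InvGoodConfig n) x x₀ ∧
        inversionDefect Δ S n =ᶠ[𝓝 x₀] 0) :
    ∃ (ρ : ℝ → ℝ) (Δ : ℝ) (S : CorrFamily 3), (∀ δ ∈ Set.Ioc (0:ℝ) 1, 0 < ρ δ) ∧ 0 < Δ ∧
      HasPointwiseScalingLimit (criticalCorr 3) ρ S ∧ IsNondegenerateTwoPoint S ∧
        IsMoebiusCovariant Δ S := by
  obtain ⟨ρ, Δ, S, hρ, hΔ, hlim, hnorm, hnd, htr, hsc⟩ := hE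
  have hcont : ∀ n, ContinuousOn (S n) (NonCoincident 3 n) := h₁ (criticalCorr 3) ρ S hlim htr
  have han : ∀ n, AnalyticOnNhd ℝ (S n) (GoodConfig n) :=
    h₂ ρ Δ S hρ hΔ hlim hnorm hnd htr hsc hcont
  have hgerm := h₅ ρ Δ S hρ hΔ hlim hnorm hnd htr hsc hcont han
  have hinv : IsInversionCovariant Δ S := h₄ Δ S hnorm hcont han h₃ hgerm
  have hrot : IsRotationInvariant S := hR Δ S htr hinv
  exact ⟨ρ, Δ, S, hρ, hΔ, hlim, hnd, ⟨htr, hrot⟩, hsc, hinv⟩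

/-- **The line concludes the crux BY NAME.** Existence without rotations (item stmt-CriticalPhenomena-1981,
`HyperoctahedralRP.ExistsScaleCovariantLimit`, shared, BY NAME — the only hypothesis) + the group lemma
(item stmt-CriticalPhenomena-4675, PROVED: `PrecisionLaplacianMoebiusLimitOfTwoPointLaw.stub_inversionBegetsRotations`)
+ the registered stubs ⇒ `Theses.PerfectScreening.MoebiusLimitExists`; the only `sorry`s in the closure
sit inside the four registered stubs (2, 3a, 4, 5′). -/
theorem MoebiusLimitExists_of
    (hE : Theses.HyperoctahedralRP.ExistsScaleCovariantLimit) :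
    Theses.PerfectScreening.MoebiusLimitExists :=
  cruxBody_of_statements hE
    Summit.CriticalPhenomena.Ising3DConformalLimit.PrecisionLaplacianMoebiusLimitOfTwoPointLaw.stub_inversionBegetsRotations
    stub_meshContinuity stub_nineMirrorAnalyticity stub_invGoodConfig_dense stub_onePointJetReduction
    stub_inversionGermOfAnalyticLimit

/-- The same composition under the primary route's spelling of the crux
(`Theses.EnergyNotSigmaSquared.MoebiusLimit`, item stmt-CriticalPhenomena-1344; one term). -/
theorem MoebiusLimit_of
    (hE : Theses.HyperoctahedralRP.ExistsScaleCovariantLimit) :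
    Theses.EnergyNotSigmaSquared.MoebiusLimit :=
  MoebiusLimitExists_of hE

end Summit.CriticalPhenomena.Ising3DConformalLimit.MoebiusLimitExistsOneMapOneJet

end
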